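import Literature.MathematicalPhysics.QuantumManyBody.PeriodicBoseGasFracEnergy
import Literature.MathematicalPhysics.QuantumManyBody.PeriodicCondensateCoherence
import Literature.MathematicalPhysics.QuantumManyBody.PeriodicBoseGasLemma33
import Mathlib.Analysis.SpecialFunctions.Gaussian.FourierTransform
import HarnessLib

/-!
# Route `BECDipoleTransport`, support `TransportToWindow` (stmt-AtomisticToContinuum-14624) —
# smearing of periodic slices: Fourier toolkit

Helper file (`--supports` stmt-AtomisticToContinuum-14624) for the proof of
`Summit.AtomisticToContinuum.BoseEinsteinCondensation.Theses.BECDipoleTransport.TransportToWindow`.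
The Gaussian-window bound of that item rests on (the inequality half of) the smeared variance
identity `2L³ Σ_{k≠0} e^{-R²p_k²/2} n_Ψ(k) = (n+1) ∭ |Ψ̄_R(x′,Y) − Ψ̄_R(x,Y)|²`; this file supplies
the one-body Fourier analysis on the cell `[0,L)³` behind it:

* `integral_kernel_sub_mul` — the substitution `∫ η(x−z)φ(z)dz = ∫ η(w)φ(x−w)dw`;
* `cellFourierCoeff_comp_sub` — translation rule `ĉ_q(φ(·−w)) = conj(e_q(w)) ĉ_q(φ)` for
  `Lℤ³`-periodic `φ`;
* `cellFourierCoeff_smear` — **convolution rule**: the cell Fourier coefficients of the smearing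
  `x ↦ ∫ η(w)φ(x−w)dw` of a bounded continuous periodic `φ` by a continuous integrable kernel are
  `η̂(q) ĉ_q(φ)`, `η̂(q) = ∫ η(w) conj(e_q(w)) dw` (Fubini on `cell × ℝ³`);
* `integral_gaussian_mul_conj_cellWave` — the **Gaussian symbol**: for the unit-mass Gaussian
  `η_R(w) = (πR²)^{-3/2}e^{-|w|²/R²}`, `η̂_R(q) = e^{-R²|2πq/L|²/4}` (Mathlib's Gaussian Fourier
  transform `GaussianFourier.integral_cexp_neg_mul_sq_norm_add`);
* `sq_tsum_le_lintegral_sub` — **variance bound through Parseval**: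
  `L³ Σ_{k≠0} |ĉ_k(F)|² ≤ ∫_cell |F(x′) − F(x)|² dx′` for continuous `F` and every `x`;
* continuity of the smeared slices of a bounded continuous `N`-body function
  (`continuous_smear`, dominated convergence), boundedness of periodic continuous functions
  (`exists_bound_of_periodic`), integrability of the Gaussian kernel, measurability of slice
  Fourier coefficients.

No new definitions. References: LSSY2005 §1.2 (occupations); Stein–Weiss, *Fourier Analysis on
Euclidean Spaces*, Ch. VII (periodisation / Fourier series of convolutions); Mathlib
`Analysis.Fourier.AddCircleMulti`, `Analysis.SpecialFunctions.Gaussian.FourierTransform`.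
-/

noncomputable section

namespace Summit.AtomisticToContinuum.BoseEinsteinCondensation.Theorems.BECDipoleTransport

open MeasureTheory
open scoped ENNReal ComplexConjugate
open Literature.MathematicalPhysics.QuantumManyBody.BoseGas

variable {L : ℝ} {n : ℕ}

/-! ### Substitution and translation -/


/-- **Substitution in the smearing integral**: `∫ η(x - z) φ(z) dz = ∫ η(w) φ(x - w) dw`
(translation and reflection invariance of Lebesgue measure on `ℝ³`). [folklore] -/
theorem integral_kernel_sub_mul (η : Space → ℝ) (φ : Space → ℂ) (x : Space) :
    ∫ z, (η (x - z) : ℂ) * φ z = ∫ w, (η w : ℂ) * φ (x - w) := by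
  have h := integral_sub_left_eq_self (fun w => (η w : ℂ) * φ (x - w)) volume x
  simp only [sub_sub_cancel] at h
  exact h

/-- `x ↦ x/L mod ℤ³` is compatible with negation. [folklore] -/
theorem toUnitTorus_neg (L : ℝ) (w : Space) : toUnitTorus L (-w) = -toUnitTorus L w := by
  funext k
  simp only [toUnitTorus, Pi.neg_apply, PiLp.neg_apply, neg_div, AddCircle.coe_neg]

/-- `e_q(-w) = conj (e_q(w))`. [folklore] -/
theorem cellWave_neg_arg (L : ℝ) (q : Fin 3 → ℤ) (w : Space) :
    cellWave L q (-w) = conj (cellWave L q w) := by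
  rw [conj_cellWave]
  unfold cellWave
  rw [toUnitTorus_neg, ← mFourier_neg_apply_neg, neg_neg]

/-- **Translation rule** for the cell Fourier coefficients of an `Lℤ³`-periodic function:
`ĉ_q(φ(· - w)) = conj(e_q(w)) ĉ_q(φ)` (translation invariance of the Haar measure of the torus).
[folklore] -/
theorem cellFourierCoeff_comp_sub (hL : 0 < L) {φ : Space → ℂ}
    (hper : ∀ (x : Space) (k : Fin 3), φ (x + EuclideanSpace.single k L) = φ x) (w : Space)
    (q : Fin 3 → ℤ) :
    cellFourierCoeff L (fun x => φ (x - w)) q = conj (cellWave L q w) * cellFourierCoeff L φ q := by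
  have htr : torusFun L (fun x => φ (x - w)) =
      fun t => torusFun L φ (t + toUnitTorus L (-w)) := by
    funext t
    have h1 := torusFun_toUnitTorus hL hper (fromUnitTorus L t + -w)
    rw [toUnitTorus_add, toUnitTorus_fromUnitTorus hL.ne'] at h1
    rw [h1, ← sub_eq_add_neg]
    rfl
  unfold cellFourierCoeff
  rw [htr, mFourierCoeff_comp_add_right, ← cellWave_neg_arg]
  rfl

/-- `∫_cell conj(e_q) ψ = L³ ĉ_q(ψ)` (the normalisation of `cellFourierCoeff`). [folklore] -/
theorem integral_cell_conj_cellWave_mul (hL : 0 < L) (ψ : Space → ℂ) (q : Fin 3 → ℤ) :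
    ∫ x in cell L, conj (cellWave L q x) * ψ x = ((L ^ 3 : ℝ) : ℂ) * cellFourierCoeff L ψ q := by
  rw [cellFourierCoeff_eq_integral hL, Complex.real_smul, ← mul_assoc]
  push_cast
  rw [mul_inv_cancel₀ (pow_ne_zero 3 (Complex.ofReal_ne_zero.2 hL.ne')), one_mul]

/-- Lebesgue measure restricted to the cell is finite. [folklore] -/
theorem isFiniteMeasure_restrict_cell (L : ℝ) :
    IsFiniteMeasure ((volume : Measure Space).restrict (cell L)) :=
  isFiniteMeasure_restrict.2 ((measure_mono (cell_subset_closedBox L)).trans_lt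
    (isCompact_closedBox L).measure_lt_top).ne

/-- **Fourier coefficients of a smeared periodic function**: for a bounded continuous
`Lℤ³`-periodic `φ` and a continuous integrable kernel `η`, the cell Fourier coefficients of the
smearing `x ↦ ∫ η(w) φ(x - w) dw` are `η̂(q) ĉ_q(φ)` with the symbol `η̂(q) = ∫ η(w) conj(e_q(w)) dw`
(Fubini on `cell × ℝ³` and the translation rule `cellFourierCoeff_comp_sub`). [folklore] -/
theorem cellFourierCoeff_smear (hL : 0 < L) {φ : Space → ℂ} (hφ : Continuous φ)
    (hper : ∀ (x : Space) (k : Fin 3), φ (x + EuclideanSpace.single k L) = φ x)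
    {M : ℝ} (hM : ∀ x, ‖φ x‖ ≤ M) {η : Space → ℝ} (hηc : Continuous η) (hηi : Integrable η)
    (q : Fin 3 → ℤ) :
    cellFourierCoeff L (fun x => ∫ w, (η w : ℂ) * φ (x - w)) q =
      (∫ w, (η w : ℂ) * conj (cellWave L q w)) * cellFourierCoeff L φ q := by
  -- the integrand of the double integral and its integrability on `cell × ℝ³`
  set F : Space → Space → ℂ := fun x w => (η w : ℂ) * (conj (cellWave L q x) * φ (x - w)) with hF
  have hFc : Continuous (Function.uncurry F) :=
    (Complex.continuous_ofReal.comp (hηc.comp continuous_snd)).mul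
      ((Complex.continuous_conj.comp ((contDiff_cellWave L q).continuous.comp continuous_fst)).mul
        (hφ.comp (continuous_fst.sub continuous_snd)))
  haveI := isFiniteMeasure_restrict_cell L
  have hint : Integrable (Function.uncurry F)
      (((volume : Measure Space).restrict (cell L)).prod volume) := by
    refine Integrable.mono' ((integrable_const M).mul_prod hηi.norm) hFc.aestronglyMeasurable
      (Filter.Eventually.of_forall ?_)
    rintro ⟨x, w⟩
    simp only [Function.uncurry_apply_pair, hF]
    rw [norm_mul, norm_mul, Complex.norm_real, Complex.norm_conj, norm_cellWave, one_mul,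
      Real.norm_eq_abs]
    calc |η w| * ‖φ (x - w)‖ ≤ |η w| * M := mul_le_mul_of_nonneg_left (hM _) (abs_nonneg _)
      _ = M * ‖η w‖ := by rw [Real.norm_eq_abs, mul_comm]
  -- Fubini
  rw [cellFourierCoeff_eq_integral hL]
  have h1 : ∀ x, conj (cellWave L q x) * ∫ w, (η w : ℂ) * φ (x - w) = ∫ w, F x w := by
    intro x
    rw [← integral_const_mul]
    refine integral_congr_ae (Filter.Eventually.of_forall fun w => ?_)
    simp only [hF]
    ring
  simp_rw [h1]
  rw [integral_integral_swap hint]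
  -- the inner integral through the translation rule
  have h2 : ∀ w, ∫ x in cell L, F x w =
      ((η w : ℂ) * conj (cellWave L q w)) * (((L ^ 3 : ℝ) : ℂ) * cellFourierCoeff L φ q) := by
    intro w
    simp only [hF]
    rw [integral_const_mul, integral_cell_conj_cellWave_mul hL (fun x => φ (x - w)) q,
      cellFourierCoeff_comp_sub hL hper w q]
    ring
  simp_rw [h2]
  rw [integral_mul_const, Complex.real_smul, ← mul_assoc, mul_comm (((L ^ 3)⁻¹ : ℝ) : ℂ),
    mul_assoc]
  congr 1
  rw [← mul_assoc]
  push_cast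
  rw [inv_mul_cancel₀ (pow_ne_zero 3 (Complex.ofReal_ne_zero.2 hL.ne')), one_mul]


/-! ### The Gaussian kernel and its symbol -/


/-- The Gaussian kernel `w ↦ A e^{-|w|²/R²}` is continuous. [folklore] -/
theorem continuous_gaussianKernel (A R : ℝ) :
    Continuous fun w : Space => A * Real.exp (-(‖w‖ ^ 2 / R ^ 2)) := by
  fun_prop

/-- The Gaussian kernel `w ↦ A e^{-|w|²/R²}` is integrable on `ℝ³` (`R ≠ 0`). [folklore] -/
theorem integrable_gaussianKernel (A : ℝ) {R : ℝ} (hR : R ≠ 0) :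
    Integrable fun w : Space => A * Real.exp (-(‖w‖ ^ 2 / R ^ 2)) := by
  have hb : 0 < ((((R ^ 2)⁻¹ : ℝ) : ℂ)).re := by
    rw [Complex.ofReal_re]; positivity
  have h := ((GaussianFourier.integrable_cexp_neg_mul_sq_norm_add hb 0 (0 : Space)).norm).const_mul A
  refine h.congr (ae_of_all _ fun w => ?_)
  simp only [zero_mul, add_zero, Complex.norm_exp]
  congr 2
  rw [← Complex.ofReal_neg, ← Complex.ofReal_pow, ← Complex.ofReal_mul, Complex.ofReal_re]
  ring



/-- The real inner product with the lattice vector `q ∈ ℤ³ ⊂ ℝ³` is the phase `q·w`. [folklore] -/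
theorem inner_intVec (q : Fin 3 → ℤ) (w : Space) :
    inner ℝ (WithLp.toLp 2 fun k => (q k : ℝ) : Space) w = ∑ k, (q k : ℝ) * w k := by
  simp [PiLp.inner_apply, mul_comm]

/-- `‖q‖² = ∑ q_k²` for the lattice vector `q ∈ ℤ³ ⊂ ℝ³`. [folklore] -/
theorem norm_sq_intVec (q : Fin 3 → ℤ) :
    ‖(WithLp.toLp 2 fun k => (q k : ℝ) : Space)‖ ^ 2 = ∑ k, (q k : ℝ) ^ 2 := by
  rw [EuclideanSpace.norm_sq_eq]
  simp [sq_abs]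

/-- `x^{3/2} = x √x` for `x ≥ 0`, complex powers. [folklore] -/
theorem ofReal_cpow_three_halves {x : ℝ} (hx : 0 < x) :
    ((x : ℂ)) ^ ((3 : ℂ) / 2) = ((x * Real.sqrt x : ℝ) : ℂ) := by
  have h : ((3 : ℂ) / 2) = ((3 / 2 : ℝ) : ℂ) := by push_cast; ring
  rw [h, ← Complex.ofReal_cpow hx.le, show (3 / 2 : ℝ) = 1 + 1 / 2 by norm_num,
    Real.rpow_add hx, Real.rpow_one, Real.sqrt_eq_rpow]

/-- **The Gaussian symbol**: for the unit-mass Gaussian `η_R(w) = (πR²)^{-3/2} e^{-|w|²/R²}` and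
`q ∈ ℤ³`, `∫ η_R(w) conj(e_q(w)) dw = e^{-R²|2πq/L|²/4}` (the Fourier transform of the Gaussian,
Mathlib's `GaussianFourier.integral_cexp_neg_mul_sq_norm_add`). [folklore] -/
theorem integral_gaussian_mul_conj_cellWave {L R : ℝ} (hL : L ≠ 0) (hR : 0 < R)
    (q : Fin 3 → ℤ) :
    ∫ w : Space, (((Real.pi * R ^ 2)⁻¹ * (Real.sqrt (Real.pi * R ^ 2))⁻¹ *
        Real.exp (-(‖w‖ ^ 2 / R ^ 2)) : ℝ) : ℂ) * conj (cellWave L q w) =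
      (Real.exp (-(R ^ 2 * (2 * Real.pi / L) ^ 2 * (∑ l, (q l : ℝ) ^ 2) / 4)) : ℂ) := by
  set P : ℝ := Real.pi * R ^ 2 with hP
  have hPpos : 0 < P := by positivity
  set b : ℂ := (((R ^ 2)⁻¹ : ℝ) : ℂ) with hb
  have hbre : 0 < b.re := by simp only [hb, Complex.ofReal_re]; positivity
  set c : ℂ := -(2 * Real.pi * Complex.I / L) with hc
  set qv : Space := WithLp.toLp 2 fun k => (q k : ℝ) with hqv
  -- the integrand is `A e^{-b|w|² + c q·w}`
  have hfun : (fun w : Space => (((Real.pi * R ^ 2)⁻¹ * (Real.sqrt (Real.pi * R ^ 2))⁻¹ *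
        Real.exp (-(‖w‖ ^ 2 / R ^ 2)) : ℝ) : ℂ) * conj (cellWave L q w)) =
      fun w => ((P⁻¹ * (Real.sqrt P)⁻¹ : ℝ) : ℂ) *
        Complex.exp (-b * (‖w‖ : ℂ) ^ 2 + c * (inner ℝ qv w : ℝ)) := by
    funext w
    rw [conj_cellWave, cellWave_apply, inner_intVec, Complex.exp_add]
    simp only [hP, hb, hc, Pi.neg_apply, Int.cast_neg, neg_mul, Finset.sum_neg_distrib]
    push_cast
    ring_nf
  rw [hfun, integral_const_mul, GaussianFourier.integral_cexp_neg_mul_sq_norm_add hbre c qv]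
  -- evaluate the constants
  have hfin : Module.finrank ℝ Space = 3 := finrank_euclideanSpace_fin
  rw [hfin]
  have hbase : (Real.pi : ℂ) / b = (P : ℂ) := by
    simp only [hb, hP]
    push_cast
    field_simp
  have hexp : c ^ 2 * (‖qv‖ : ℂ) ^ 2 / (4 * b) =
      ((-(R ^ 2 * (2 * Real.pi / L) ^ 2 * (∑ l, (q l : ℝ) ^ 2) / 4) : ℝ) : ℂ) := by
    have hq2 : ((‖qv‖ : ℂ)) ^ 2 = ((∑ l, (q l : ℝ) ^ 2 : ℝ) : ℂ) := by
      rw [← Complex.ofReal_pow, norm_sq_intVec]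
    rw [hq2]
    simp only [hc, hb]
    have hR2 : ((R ^ 2 : ℝ) : ℂ) ≠ 0 := by exact_mod_cast (pow_ne_zero 2 hR.ne')
    have hL' : (L : ℂ) ≠ 0 := Complex.ofReal_ne_zero.2 hL
    push_cast
    field_simp
    rw [Complex.I_sq]
    ring
  rw [hbase, hexp, show ((3 : ℕ) : ℂ) / 2 = (3 : ℂ) / 2 by push_cast; ring,
    ofReal_cpow_three_halves hPpos, ← Complex.ofReal_exp, ← Complex.ofReal_mul,
    ← Complex.ofReal_mul, ← mul_assoc]
  congr 1
  have hsq : Real.sqrt P ≠ 0 := (Real.sqrt_pos.2 hPpos).ne'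
  field_simp


/-! ### Smeared slices of `N`-body functions -/

/-- A continuous function on `(ℝ³)^N` that is `Lℤ³`-periodic in every particle is bounded (it
factors through the compact torus). [folklore] -/
theorem exists_bound_of_periodic (hL : 0 < L) {N : ℕ} {Ψ : Config N → ℂ} (hΨ : Continuous Ψ)
    (hper : ∀ (X : Config N) (i : Fin N) (k : Fin 3),
      Ψ (X + Pi.single i (EuclideanSpace.single k L)) = Ψ X) :
    ∃ M, ∀ X, ‖Ψ X‖ ≤ M := by
  obtain ⟨C, hC⟩ := exists_bound_torusFunN hL hΨ
  refine ⟨C, fun X => ?_⟩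
  obtain ⟨m, hm⟩ := exists_fromUnitTorusN_toUnitTorusN_eq hL X
  have h := hC (toUnitTorusN L X)
  rwa [hm, IsTorusPeriodic.add_latticeVecN hper] at h

/-- **Continuity of the smeared slices**: for a bounded continuous `Ψ` on `(ℝ³)^{n+1}` and a
continuous integrable kernel `η`, `(x, Y) ↦ ∫ η(w) Ψ(x - w, Y) dw` is continuous (dominated
convergence with the bound `M|η|`). [folklore] -/
theorem continuous_smear {Ψ : Config (n + 1) → ℂ} (hΨ : Continuous Ψ) {M : ℝ}
    (hM : ∀ X, ‖Ψ X‖ ≤ M) {η : Space → ℝ} (hηc : Continuous η) (hηi : Integrable η) :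
    Continuous fun p : Space × Config n =>
      ∫ w, (η w : ℂ) * Ψ (Matrix.vecCons (p.1 - w) p.2) := by
  refine continuous_of_dominated (bound := fun w => ‖η w‖ * M) ?_ ?_ (hηi.norm.mul_const M) ?_
  · intro p
    exact ((Complex.continuous_ofReal.comp hηc).mul
      (hΨ.comp ((continuous_const.sub continuous_id).matrixVecCons continuous_const))).aestronglyMeasurable
  · intro p
    refine ae_of_all _ fun w => ?_
    rw [norm_mul, Complex.norm_real]
    exact mul_le_mul_of_nonneg_left (hM _) (norm_nonneg _)
  · refine ae_of_all _ fun w => ?_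
    exact (continuous_const.mul (hΨ.comp
      ((continuous_fst.sub continuous_const).matrixVecCons continuous_snd)))


/-! ### Parseval: variance bound and measurability of slice coefficients -/


/-- A constant has no non-zero Fourier modes: subtracting a constant from a continuous function
does not change its non-zero cell Fourier coefficients. [folklore] -/
theorem cellFourierCoeff_sub_const (hL : 0 < L) {F : Space → ℂ} (hF : Continuous F) (a : ℂ)
    {k : Fin 3 → ℤ} (hk : k ≠ 0) :
    cellFourierCoeff L (fun x => F x - a) k = cellFourierCoeff L F k := by
  rw [cellFourierCoeff_eq_integral hL, cellFourierCoeff_eq_integral hL]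
  congr 1
  have hcw : Continuous fun y : Space => conj (cellWave L k y) :=
    Complex.continuous_conj.comp (contDiff_cellWave L k).continuous
  have hi1 : IntegrableOn (fun y : Space => conj (cellWave L k y) * F y) (cell L) volume :=
    integrableOn_cell (hcw.mul hF)
  have hi2 : IntegrableOn (fun y : Space => conj (cellWave L k y) * a) (cell L) volume :=
    integrableOn_cell (hcw.mul continuous_const)
  simp_rw [mul_sub]
  rw [integral_sub hi1 hi2, integral_mul_const]
  simp_rw [conj_cellWave]
  rw [integral_cell_cellWave_eq_zero hL (neg_ne_zero.2 hk), zero_mul, sub_zero]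

/-- **Variance bound through Parseval** (pointwise in the reference point): for continuous `F`
and any `x`, `L³ Σ_{k ≠ 0} |ĉ_k(F)|² ≤ ∫_cell |F(x') - F(x)|² dx'` (Parseval on the cell for
`F - F(x)`, whose non-zero modes are those of `F`, dropping the zero mode). [folklore] -/
theorem sq_tsum_le_lintegral_sub (hL : 0 < L) {F : Space → ℂ} (hF : Continuous F) (x : Space) :
    ENNReal.ofReal L ^ 3 * (∑' k : Fin 3 → ℤ,
        if k ≠ 0 then ((‖cellFourierCoeff L F k‖₊ : ℝ≥0∞) ^ 2) else 0) ≤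
      ∫⁻ x' in cell L, (‖F x' - F x‖₊ : ℝ≥0∞) ^ 2 := by
  have hL3 : ENNReal.ofReal L ^ 3 ≠ 0 := pow_ne_zero _ (by simpa using hL)
  have hL3' : ENNReal.ofReal L ^ 3 ≠ ⊤ := ENNReal.pow_ne_top ENNReal.ofReal_ne_top
  have hc : Continuous fun x' => F x' - F x := hF.sub continuous_const
  have hP := tsum_sq_cellFourierCoeff hL hc
  calc ENNReal.ofReal L ^ 3 * (∑' k : Fin 3 → ℤ,
        if k ≠ 0 then ((‖cellFourierCoeff L F k‖₊ : ℝ≥0∞) ^ 2) else 0)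
      ≤ ENNReal.ofReal L ^ 3 * ∑' k : Fin 3 → ℤ,
          (‖cellFourierCoeff L (fun x' => F x' - F x) k‖₊ : ℝ≥0∞) ^ 2 := by
        refine mul_le_mul' le_rfl (ENNReal.tsum_le_tsum fun k => ?_)
        split_ifs with hk
        · rw [cellFourierCoeff_sub_const hL hF (F x) hk]
        · exact zero_le
    _ = ∫⁻ x' in cell L, (‖F x' - F x‖₊ : ℝ≥0∞) ^ 2 := by
        rw [hP, ← mul_assoc, ENNReal.mul_inv_cancel hL3 hL3', one_mul]

/-- Measurability in the spectator variables of the slice Fourier coefficients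
`Y ↦ ĉ_k(Ψ(·, Y))` (continuous `Ψ`). [folklore] -/
theorem measurable_cellFourierCoeff_slice (hL : 0 < L) {Ψ : Config (n + 1) → ℂ}
    (hΨ : Continuous Ψ) (k : Fin 3 → ℤ) :
    Measurable fun Y : Config n => cellFourierCoeff L (fun x => Ψ (Matrix.vecCons x Y)) k := by
  have h : StronglyMeasurable (Function.uncurry fun (Y : Config n) (x : Space) =>
      conj (cellWave L k x) * Ψ (Matrix.vecCons x Y)) := by
    refine Continuous.stronglyMeasurable ?_
    exact (Complex.continuous_conj.comp ((contDiff_cellWave L k).continuous.comp continuous_snd)).mul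
      (hΨ.comp (continuous_snd.matrixVecCons continuous_fst))
  have h2 := h.integral_prod_right' (ν := volume.restrict (cell L))
  have heq : (fun Y : Config n => cellFourierCoeff L (fun x => Ψ (Matrix.vecCons x Y)) k) =
      fun Y => ((L ^ 3)⁻¹ : ℝ) • ∫ x in cell L, conj (cellWave L k x) * Ψ (Matrix.vecCons x Y) :=
    funext fun Y => cellFourierCoeff_eq_integral hL _ k
  rw [heq]
  exact h2.measurable.const_smul ((L ^ 3)⁻¹ : ℝ)

end Summit.AtomisticToContinuum.BoseEinsteinCondensation.Theorems.BECDipoleTransport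

end
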